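import Literature.AlgebraicGeometry.Modules.QcohLocalization
import Mathlib.AlgebraicGeometry.Morphisms.QuasiCompact
import HarnessLib

/-!
# Affine-localizing sheaves of modules (numerators and torsion on the principal opens of affine opens)

A sheaf of `𝒪_X`-modules `M` on a scheme `X` is **affine-localizing** (`IsAffineLocalizing M`) if
for every AFFINE open `V ⊆ X` and every `r ∈ Γ(V, 𝒪_X)` the restriction `Γ(V, M) → Γ(D(r), M)`
has the two properties of a localization at `r`:
(numerators) every section over `D(r)` is `x|_{D(r)} / r^n` for some `x ∈ Γ(V, M)`, and
(torsion) a section over `V` vanishing on (an open between `V` and) `D(r)` is killed by a power of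
`r`. These are conditions d1) and d2) of Grothendieck's characterisation of quasi-coherence (EGA I,
new ed., Thm. 1.4.1) and (a), (b) of Hartshorne II Lemma 5.3; Mathlib uses the same two conditions
privately (`AlgebraicGeometry.QuasicoherentTilde.Aux`) to prove `isIso_fromTildeΓ` for quasi-coherent
modules on affine schemes. We record them as a named, affine-local PROPERTY because it is exactly
what the Čech computations of `Literature/AlgebraicGeometry/Morphisms/CechModuleAffine*` consume, and
because — unlike Mathlib's `SheafOfModules.IsQuasicoherent` (local presentations) — it is checked on
sections, so that it passes to kernels, extensions, quotients and torsion subsheaves by elementary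
diagram chases (sibling files):

* `IsAffineLocalizing M` — the structure (a `Prop`);
* `IsAffineLocalizing.of_isQuasicoherent` — **quasi-coherent modules are affine-localizing**
  (`Modules/QcohLocalization`, Hartshorne II Lemma 5.3);
* `IsAffineLocalizing.unit` — the structure sheaf is (Mathlib `IsAffineOpen.isLocalization_basicOpen`).

Everything is proved; no named facts. Mathlib searched (pin v4.32): `SheafOfModules.IsQuasicoherent`,
`AlgebraicGeometry.isIso_fromTildeΓ_iff_isLocalizing` (affine schemes only), the private
`QuasicoherentTilde.Aux` (same two conditions); no public affine-local formulation.

## References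

* A. Grothendieck, J. Dieudonné, *Éléments de géométrie algébrique I* (Springer, 1971), Thm. 1.4.1,
  conditions d1), d2) (as cited by Mathlib's `Modules/Tilde`). [folklore]
* R. Hartshorne, *Algebraic Geometry*, GTM 52, Springer (1977): II Lemma 5.3, p. 112 (PDF p. 141).
  [Hartshorne1977]
-/

noncomputable section

open CategoryTheory AlgebraicGeometry TopologicalSpace Opposite

universe u

namespace Literature.AlgebraicGeometry.Modules

variable {X : Scheme.{u}} (M : X.Modules)

/-- **Affine-localizing sheaves of modules** (EGA I Thm. 1.4.1 d1), d2); Hartshorne II Lemma 5.3):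
for every affine open `V`, every `r ∈ Γ(V, 𝒪_X)`:
`numerator` — every section `s` of `M` over `W = D(r)` satisfies `x|_W = r^n|_W • s` for some `n`
and some `x ∈ Γ(V, M)`;
`torsion` — a section `x ∈ Γ(V, M)` restricting to `0` on an open `W` with `D(r) ⊆ W ⊆ V` satisfies
`r^n • x = 0` for some `n`. [cite: Hartshorne1977, II Lemma 5.3 p. 112 (PDF p. 141)] -/
structure IsAffineLocalizing : Prop where
  /-- numerators: sections over `D(r)` extend after multiplication by a power of `r` -/
  numerator : ∀ ⦃V : X.Opens⦄ (_ : IsAffineOpen V) (r : Γ(X, V)) {W : X.Opens}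
    (hW : W = X.basicOpen r) (s : Γ(M, W)), ∃ (n : ℕ) (x : Γ(M, V)),
      M.presheaf.map (homOfLE (hW.trans_le (X.basicOpen_le r))).op x =
        X.presheaf.map (homOfLE (hW.trans_le (X.basicOpen_le r))).op r ^ n • s
  /-- torsion: sections vanishing on `D(r)` are killed by a power of `r` -/
  torsion : ∀ ⦃V : X.Opens⦄ (_ : IsAffineOpen V) (r : Γ(X, V)) (x : Γ(M, V)) {W : X.Opens}
    (hWV : W ≤ V) (_ : X.basicOpen r ≤ W), M.presheaf.map (homOfLE hWV).op x = 0 → ∃ n : ℕ, r ^ n • x = 0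

/-- **Quasi-coherent modules are affine-localizing** (Hartshorne II Lemma 5.3 for the affine open
`V`; `Modules/QcohLocalization`). [cite: Hartshorne1977, II Lemma 5.3 p. 112 (PDF p. 141)] -/
theorem IsAffineLocalizing.of_isQuasicoherent [M.IsQuasicoherent] : IsAffineLocalizing M :=
  ⟨fun _ hV r _ hW s => exists_map_eq_pow_smul M hV r hW s,
    fun _ hV r x _ hWV hrW hx => exists_pow_smul_eq_zero M hV r x hWV hrW hx⟩

/-- **The structure sheaf is affine-localizing**: `Γ(D(r), 𝒪_X) = Γ(V, 𝒪_X)_r` (Mathlib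
`IsAffineOpen.isLocalization_basicOpen`). [folklore] -/
theorem IsAffineLocalizing.unit : IsAffineLocalizing (SheafOfModules.unit X.ringCatSheaf) := by
  constructor
  · intro V hV r W hW s
    subst hW
    haveI := hV.isLocalization_basicOpen r
    obtain ⟨⟨x, ⟨_, n, rfl⟩⟩, hx⟩ :=
      IsLocalization.surj (Submonoid.powers r) (S := Γ(X, X.basicOpen r)) s
    refine ⟨n, x, ?_⟩
    change X.presheaf.map _ x = @HMul.hMul Γ(X, X.basicOpen r) Γ(X, X.basicOpen r) Γ(X, X.basicOpen r)
      instHMul (X.presheaf.map (homOfLE (X.basicOpen_le r)).op r ^ n) s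
    rw [map_pow, mul_comm] at hx
    exact hx.symm
  · intro V hV r x W hWV hrW hx
    have hx' : X.presheaf.map (homOfLE hWV).op (x : Γ(X, V)) = 0 := hx
    have h2 := congrArg (X.presheaf.map (homOfLE hrW).op) hx'
    rw [map_zero, ← CategoryTheory.comp_apply, ← Functor.map_comp] at h2
    obtain ⟨n, hn⟩ := exists_pow_mul_eq_zero_of_res_basicOpen_eq_zero_of_isAffineOpen X hV
      (x : Γ(X, V)) r h2
    exact ⟨n, hn⟩

end Literature.AlgebraicGeometry.Modules

end
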